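import Literature.Barriers.CriticalPhenomena.TimarEdgeRatioQuasiTransitive
import Literature.Barriers.CriticalPhenomena.TimarEncounterPoints
import Literature.Barriers.CriticalPhenomena.TimarCutQuasiTransitive
import HarnessLib

/-!
# Timár 2006, Lemma 5.2 on QUASI-TRANSITIVE graphs: a heavy cluster meets every slab in
# infinitely many vertices — PROVED (weights, extreme edge ratio `δ`)

Barrier catalogue `Literature/Barriers/CriticalPhenomena/`; the quasi-transitive twin of
`TimarHeavySlabs.lean` (TRANSITIVE graphs), in the same WEIGHT vocabulary (`autWeight G o`,
`IsHeavy`, `IsTopOf`/`IsBotOf`, `topTransport`/`botTransport`, `weightSlab`, all reused) with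
`Δ = minNbrWeight G o` replaced by the extreme edge ratio `δ = minEdgeRatio G` of
`TimarEdgeRatioQuasiTransitive.lean`. Á. Timár, *Percolation on nonunimodular transitive graphs*,
Ann. Probab. 34 (2006) 2344–2364, §5:

> **Lemma 5.2.** A heavy cluster intersects every slab in infinitely many vertices.
>
> *Proof.* Otherwise, by deletion tolerance, with positive probability there would be a heavy
> cluster that does not have any vertex below (resp. above) a certain level. Then by insertion
> tolerance, there would also be a heavy cluster with a single lowest (resp. uppermost) vertex.
> Let every vertex of the cluster send unit mass to this vertex. This contradicts the MTP. □

What changes with respect to the transitive file: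

* **the MTP step** uses the quasi-transitive tilted MTP summed over a complete set of orbit
  representatives (`sum_inv_autWeight_mul_lintegral_tsum_eq_tilted`,
  `NonunimodularMTPQuasiTransitive.lean`): the summed mass sent is `≤ Σ_r w(r)⁻¹ < ∞`, while a
  unique top of a heavy cluster at a representative would receive `Δ`-weighted mass `∞`; the null
  events are moved from the representatives to every vertex by invariance
  (`measure_isHeavy_and_isTopOf_eq_zero'`, `measure_isHeavy_and_isBotOf_eq_zero'`);
* **"a single uppermost (lowest) vertex" by insertion tolerance**: a quasi-transitive graph need
  not have long edges; instead, from every vertex `v` there are walks of bounded length to vertices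
  of weight `c · w(v)` and `c⁻¹ · w(v)`, `c > 1` fixed (`exists_climb`, `exists_descent`,
  `TimarEdgeRatioQuasiTransitive.lean`). If `C(v)` is heavy with all weights `< c w(v)`, close the
  edges at the vertices of the climbing walk after its last visit to `C(v)` up to its first
  highest vertex `u*` and open the walk in between: `u*` becomes the unique top of the heavy
  cluster `C(v) ∪ {walk}` — and symmetrically downwards. Both are one argument on an abstract key
  `κ : V → [0, ∞]` (`walk_mem_keyTopEvent`, `ae_not_forall_key_lt`), instantiated with `κ = w`
  and `κ = w⁻¹`;
* the slabs `{a < w ≤ b}`, `a ≤ δ b`, separate (`TimarEdgeRatioQuasiTransitive.lean`).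

Main result: `ae_infinite_inter_weightSlab_quasiTransitive` (Lemma 5.2); on the way
`ae_not_isTopOf'`, `ae_not_isBotOf'`, `ae_exists_lt_autWeight'`, `ae_exists_autWeight_lt'`; and the
corollary for heavy BRANCHES, `ae_infinite_branchSet_inter_weightSlab'` (the quasi-transitive
twin of the one transitive statement of `TimarEncounterPoints.lean`).

## References

* Á. Timár, Ann. Probab. 34 (2006) 2344–2364 (arXiv:math/0702875), §5, Lemma 5.2 and its proof;
  Lemma 5.3 (proof: "C ∩ L₀ is infinite, by deletion tolerance and Lemma 5.2"); Lemma 2.2 (MTP).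
  [Timar2006]
* R. Lyons, Y. Peres, *Probability on Trees and Networks*, CUP 2016, §7.3 (insertion and
  deletion tolerance), §8.2 ((8.10), Cor. 8.11). [LyonsPeres2016]
* T. Hutchcroft, C. R. Math. Acad. Sci. Paris 354 (2016) 944–947, §2 (quasi-transitive setting).
  [Hutchcroft2016]
-/

noncomputable section

namespace Literature.Barriers.CriticalPhenomena

open _root_.MeasureTheory _root_.ProbabilityTheory _root_.Filter
  Literature.Probability.LatticeModels Literature.Probability.Percolation SimpleGraph
open scoped _root_.ENNReal

variable {V : Type*}

/-! ### "Let every vertex of the cluster send unit mass to this vertex": no unique extremal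
vertex (quasi-transitive MTP) -/

section NoExtremalVertex

variable {G : SimpleGraph V} [G.LocallyFinite] {o : V}

/-- **The unique top of a heavy cluster receives infinite `Δ`-weighted mass**: if `C(x)` is heavy
with unique top `x`, then `Σ_y topTransport(y, x) Δ(y) = Σ_{y ∈ C(x)} Δ(y) = ∞` (the relative
weights `Δ(y) = w(y)/w(o(y))` dominate `w(y)/max_R w`).
[cite: Timar2006, Lemma 5.2 (proof: "This contradicts the MTP")] -/
theorem tsum_topTransport_mul_relWeight_eq_top (hconn : G.Connected) {R : Finset V}
    (hR : ∀ v : V, ∃ r ∈ R, v ∈ autOrbit G r) (hRne : R.Nonempty) {ω : BondConfig V} {x : V}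
    (hH : IsHeavy G o (openCluster ω x)) (hT : IsTopOf G o (openCluster ω x) x) :
    ∑' y, topTransport G o ω y x * relWeight G R y = ⊤ := by
  have h : ∀ y, topTransport G o ω y x * relWeight G R y = (openCluster ω x).indicator (relWeight G R) y := by
    intro y
    by_cases hy : y ∈ openCluster ω x
    · have hC : openCluster ω y = openCluster ω x := openCluster_eq_openCluster_of_mem hy
      rw [Set.indicator_of_mem hy, topTransport, Set.indicator_of_mem, Pi.one_apply, one_mul]
      exact ⟨hC ▸ hH, hC ▸ hT⟩
    · rw [Set.indicator_of_notMem hy, topTransport, Set.indicator_of_notMem, zero_mul]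
      rintro ⟨-, hT'⟩
      exact hy (mem_openCluster_comm.1 hT'.1)
  simp_rw [h]
  have hle : setWeight G o (openCluster ω x) ≤
      repWeightMax G o R hRne * ∑' y, (openCluster ω x).indicator (relWeight G R) y := by
    rw [setWeight, ← ENNReal.tsum_mul_left]
    refine ENNReal.tsum_le_tsum fun y => ?_
    by_cases hy : y ∈ openCluster ω x
    · rw [Set.indicator_of_mem hy, Set.indicator_of_mem hy, mul_comm]
      exact autWeight_le_relWeight_mul_repWeightMax hconn o hR hRne y
    · simp [Set.indicator_of_notMem hy]
  rw [show setWeight G o (openCluster ω x) = ⊤ from hH, top_le_iff, ENNReal.mul_eq_top] at hle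
  rcases hle with ⟨-, h'⟩ | ⟨h', -⟩
  · exact h'
  · exact absurd h' (repWeightMax_ne_top hconn o hRne)

/-- The unique bottom of a heavy cluster receives infinite `Δ`-weighted mass.
[cite: Timar2006, Lemma 5.2 (proof: "This contradicts the MTP")] -/
theorem tsum_botTransport_mul_relWeight_eq_top (hconn : G.Connected) {R : Finset V}
    (hR : ∀ v : V, ∃ r ∈ R, v ∈ autOrbit G r) (hRne : R.Nonempty) {ω : BondConfig V} {x : V}
    (hH : IsHeavy G o (openCluster ω x)) (hB : IsBotOf G o (openCluster ω x) x) :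
    ∑' y, botTransport G o ω y x * relWeight G R y = ⊤ := by
  have h : ∀ y, botTransport G o ω y x * relWeight G R y = (openCluster ω x).indicator (relWeight G R) y := by
    intro y
    by_cases hy : y ∈ openCluster ω x
    · have hC : openCluster ω y = openCluster ω x := openCluster_eq_openCluster_of_mem hy
      rw [Set.indicator_of_mem hy, botTransport, Set.indicator_of_mem, Pi.one_apply, one_mul]
      exact ⟨hC ▸ hH, hC ▸ hB⟩
    · rw [Set.indicator_of_notMem hy, botTransport, Set.indicator_of_notMem, zero_mul]
      rintro ⟨-, hB'⟩
      exact hy (mem_openCluster_comm.1 hB'.1)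
  simp_rw [h]
  have hle : setWeight G o (openCluster ω x) ≤
      repWeightMax G o R hRne * ∑' y, (openCluster ω x).indicator (relWeight G R) y := by
    rw [setWeight, ← ENNReal.tsum_mul_left]
    refine ENNReal.tsum_le_tsum fun y => ?_
    by_cases hy : y ∈ openCluster ω x
    · rw [Set.indicator_of_mem hy, Set.indicator_of_mem hy, mul_comm]
      exact autWeight_le_relWeight_mul_repWeightMax hconn o hR hRne y
    · simp [Set.indicator_of_notMem hy]
  rw [show setWeight G o (openCluster ω x) = ⊤ from hH, top_le_iff, ENNReal.mul_eq_top] at hle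
  rcases hle with ⟨-, h'⟩ | ⟨h', -⟩
  · exact h'
  · exact absurd h' (repWeightMax_ne_top hconn o hRne)

variable [Countable V]

omit [Countable V] in
/-- The top event has the same probability along an orbit. [folklore] -/
theorem measure_topEvent_map (hconn : G.Connected) (p : unitInterval) (γ : G ≃g G) (x : V) :
    bondPercolation G p {ω | IsHeavy G o (openCluster ω (γ x)) ∧ IsTopOf G o (openCluster ω (γ x)) (γ x)} =
      bondPercolation G p {ω | IsHeavy G o (openCluster ω x) ∧ IsTopOf G o (openCluster ω x) x} := by
  have hpre : BondConfig.relabel (sym2Equiv γ.toEquiv) ⁻¹'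
      {ω | IsHeavy G o (openCluster ω (γ x)) ∧ IsTopOf G o (openCluster ω (γ x)) (γ x)} =
      {ω | IsHeavy G o (openCluster ω x) ∧ IsTopOf G o (openCluster ω x) x} := by
    ext ω
    have hC : openCluster (BondConfig.relabel (sym2Equiv γ.toEquiv) ω) (γ x) = (γ : V → V) '' openCluster ω x :=
      openCluster_relabel γ.toEquiv ω x
    simp only [Set.mem_preimage, Set.mem_setOf_eq, hC, isHeavy_image_iff G hconn γ o,
      isTopOf_image_iff G hconn γ o]
  calc bondPercolation G p {ω | IsHeavy G o (openCluster ω (γ x)) ∧ IsTopOf G o (openCluster ω (γ x)) (γ x)}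
      = ((bondPercolation G p).map (BondConfig.relabel (sym2Equiv γ.toEquiv)))
          {ω | IsHeavy G o (openCluster ω (γ x)) ∧ IsTopOf G o (openCluster ω (γ x)) (γ x)} := by
        rw [bondPercolation_map_relabel_iso]
    _ = bondPercolation G p (BondConfig.relabel (sym2Equiv γ.toEquiv) ⁻¹'
          {ω | IsHeavy G o (openCluster ω (γ x)) ∧ IsTopOf G o (openCluster ω (γ x)) (γ x)}) :=
        MeasurableEquiv.map_apply _ _
    _ = _ := by rw [hpre]

omit [Countable V] in
/-- The bottom version of `measure_topEvent_map`. [folklore] -/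
theorem measure_botEvent_map (hconn : G.Connected) (p : unitInterval) (γ : G ≃g G) (x : V) :
    bondPercolation G p {ω | IsHeavy G o (openCluster ω (γ x)) ∧ IsBotOf G o (openCluster ω (γ x)) (γ x)} =
      bondPercolation G p {ω | IsHeavy G o (openCluster ω x) ∧ IsBotOf G o (openCluster ω x) x} := by
  have hpre : BondConfig.relabel (sym2Equiv γ.toEquiv) ⁻¹'
      {ω | IsHeavy G o (openCluster ω (γ x)) ∧ IsBotOf G o (openCluster ω (γ x)) (γ x)} =
      {ω | IsHeavy G o (openCluster ω x) ∧ IsBotOf G o (openCluster ω x) x} := by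
    ext ω
    have hC : openCluster (BondConfig.relabel (sym2Equiv γ.toEquiv) ω) (γ x) = (γ : V → V) '' openCluster ω x :=
      openCluster_relabel γ.toEquiv ω x
    simp only [Set.mem_preimage, Set.mem_setOf_eq, hC, isHeavy_image_iff G hconn γ o,
      isBotOf_image_iff G hconn γ o]
  calc bondPercolation G p {ω | IsHeavy G o (openCluster ω (γ x)) ∧ IsBotOf G o (openCluster ω (γ x)) (γ x)}
      = ((bondPercolation G p).map (BondConfig.relabel (sym2Equiv γ.toEquiv)))
          {ω | IsHeavy G o (openCluster ω (γ x)) ∧ IsBotOf G o (openCluster ω (γ x)) (γ x)} := by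
        rw [bondPercolation_map_relabel_iso]
    _ = bondPercolation G p (BondConfig.relabel (sym2Equiv γ.toEquiv) ⁻¹'
          {ω | IsHeavy G o (openCluster ω (γ x)) ∧ IsBotOf G o (openCluster ω (γ x)) (γ x)}) :=
        MeasurableEquiv.map_apply _ _
    _ = _ := by rw [hpre]

/-- **The MTP step of Lemma 5.2 on a quasi-transitive graph**: for every vertex `x`, the event
"`C(x)` is heavy and `x` is its unique uppermost vertex" is null. At the representatives: the
summed expected mass sent is `≤ Σ_r w(r)⁻¹ < ∞`, the summed `Δ`-weighted mass received is `∞` as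
soon as one of the events is positive, and the quasi-transitive Lemma 2.2
(`sum_inv_autWeight_mul_lintegral_tsum_eq_tilted`) equates them; then invariance along orbits.
[cite: Timar2006, Lemma 5.2 (proof: MTP contradiction)] [cite: LyonsPeres2016, §8.2 (Cor. 8.11)] -/
theorem measure_isHeavy_and_isTopOf_eq_zero' (hconn : G.Connected) (hqt : IsQuasiTransitive G)
    (p : unitInterval) (o x : V) :
    bondPercolation G p {ω | IsHeavy G o (openCluster ω x) ∧ IsTopOf G o (openCluster ω x) x} = 0 := by
  set μ := bondPercolation G p with hμ
  obtain ⟨R, hR, hR'⟩ := hqt.exists_orbit_representatives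
  have hRne : R.Nonempty := by obtain ⟨r, hr, -⟩ := hR o; exact ⟨r, hr⟩
  have hrep : ∀ r ∈ R, μ {ω | IsHeavy G o (openCluster ω r) ∧ IsTopOf G o (openCluster ω r) r} = 0 := by
    by_contra hno
    push Not at hno
    obtain ⟨r, hr, hne⟩ := hno
    set E := {ω : BondConfig V | IsHeavy G o (openCluster ω r) ∧ IsTopOf G o (openCluster ω r) r} with hE
    have hEm : MeasurableSet E :=
      (measurableSet_isHeavy_openCluster G o r).inter (measurableSet_isTopOf_openCluster_comp measurable_id G o r r)
    have hmtp := sum_inv_autWeight_mul_lintegral_tsum_eq_tilted G hconn R hR hR' μ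
      (fun γ => (BondConfig.relabel (sym2Equiv γ.toEquiv) : BondConfig V → BondConfig V))
      (fun γ => (BondConfig.relabel (sym2Equiv γ.toEquiv)).measurable)
      (fun γ => bondPercolation_map_relabel_iso γ p)
      (F := fun x y ω => topTransport G o ω x y) (fun x y => measurable_topTransport o x y)
      (fun γ x y ω => topTransport_relabel hconn γ o ω x y) o
    have hle : ∑ i ∈ R, (autWeight G o i)⁻¹ * ∫⁻ ω, ∑' y, topTransport G o ω i y ∂μ ≠ ⊤ := by
      refine ENNReal.sum_ne_top.2 fun i _ => ENNReal.mul_ne_top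
        (ENNReal.inv_ne_top.2 (autWeight_ne_zero G hconn o i)) (ne_top_of_le_ne_top ENNReal.one_ne_top ?_)
      calc ∫⁻ ω, ∑' y, topTransport G o ω i y ∂μ ≤ ∫⁻ _, 1 ∂μ :=
            lintegral_mono fun ω => tsum_topTransport_le_one o ω i
        _ = 1 := by rw [lintegral_const, measure_univ, mul_one]
    have hge : ∫⁻ ω, ∑' y, topTransport G o ω y r * relWeight G R y ∂μ = ⊤ := by
      refine eq_top_iff.2 ?_
      calc (⊤ : ℝ≥0∞) = ⊤ * μ E := by rw [ENNReal.top_mul hne]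
        _ = ∫⁻ ω, E.indicator (fun _ => (⊤ : ℝ≥0∞)) ω ∂μ := by rw [lintegral_indicator_const hEm]
        _ ≤ ∫⁻ ω, ∑' y, topTransport G o ω y r * relWeight G R y ∂μ := by
            refine lintegral_mono fun ω => ?_
            by_cases hω : ω ∈ E
            · rw [Set.indicator_of_mem hω, tsum_topTransport_mul_relWeight_eq_top hconn hR hRne hω.1 hω.2]
            · rw [Set.indicator_of_notMem hω]
              exact bot_le
    have htop : ∑ j ∈ R, (autWeight G o j)⁻¹ * ∫⁻ ω, ∑' y, topTransport G o ω y j * relWeight G R y ∂μ = ⊤ := by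
      refine ENNReal.sum_eq_top.2 ⟨r, hr, ?_⟩
      rw [hge, ENNReal.mul_top (ENNReal.inv_ne_zero.2 (autWeight_ne_top G hconn o r))]
    rw [htop] at hmtp
    exact hle hmtp
  obtain ⟨r, hr, ⟨γ, rfl⟩⟩ := hR x
  rw [hμ, measure_topEvent_map hconn p γ r]
  exact hrep r hr

/-- The bottom version: "`C(x)` is heavy and `x` is its unique lowest vertex" is null.
[cite: Timar2006, Lemma 5.2 (proof: MTP contradiction)] -/
theorem measure_isHeavy_and_isBotOf_eq_zero' (hconn : G.Connected) (hqt : IsQuasiTransitive G)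
    (p : unitInterval) (o x : V) :
    bondPercolation G p {ω | IsHeavy G o (openCluster ω x) ∧ IsBotOf G o (openCluster ω x) x} = 0 := by
  set μ := bondPercolation G p with hμ
  obtain ⟨R, hR, hR'⟩ := hqt.exists_orbit_representatives
  have hRne : R.Nonempty := by obtain ⟨r, hr, -⟩ := hR o; exact ⟨r, hr⟩
  have hrep : ∀ r ∈ R, μ {ω | IsHeavy G o (openCluster ω r) ∧ IsBotOf G o (openCluster ω r) r} = 0 := by
    by_contra hno
    push Not at hno
    obtain ⟨r, hr, hne⟩ := hno
    set E := {ω : BondConfig V | IsHeavy G o (openCluster ω r) ∧ IsBotOf G o (openCluster ω r) r} with hE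
    have hEm : MeasurableSet E :=
      (measurableSet_isHeavy_openCluster G o r).inter (measurableSet_isBotOf_openCluster_comp measurable_id G o r r)
    have hmtp := sum_inv_autWeight_mul_lintegral_tsum_eq_tilted G hconn R hR hR' μ
      (fun γ => (BondConfig.relabel (sym2Equiv γ.toEquiv) : BondConfig V → BondConfig V))
      (fun γ => (BondConfig.relabel (sym2Equiv γ.toEquiv)).measurable)
      (fun γ => bondPercolation_map_relabel_iso γ p)
      (F := fun x y ω => botTransport G o ω x y) (fun x y => measurable_botTransport o x y)
      (fun γ x y ω => botTransport_relabel hconn γ o ω x y) o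
    have hle : ∑ i ∈ R, (autWeight G o i)⁻¹ * ∫⁻ ω, ∑' y, botTransport G o ω i y ∂μ ≠ ⊤ := by
      refine ENNReal.sum_ne_top.2 fun i _ => ENNReal.mul_ne_top
        (ENNReal.inv_ne_top.2 (autWeight_ne_zero G hconn o i)) (ne_top_of_le_ne_top ENNReal.one_ne_top ?_)
      calc ∫⁻ ω, ∑' y, botTransport G o ω i y ∂μ ≤ ∫⁻ _, 1 ∂μ :=
            lintegral_mono fun ω => tsum_botTransport_le_one o ω i
        _ = 1 := by rw [lintegral_const, measure_univ, mul_one]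
    have hge : ∫⁻ ω, ∑' y, botTransport G o ω y r * relWeight G R y ∂μ = ⊤ := by
      refine eq_top_iff.2 ?_
      calc (⊤ : ℝ≥0∞) = ⊤ * μ E := by rw [ENNReal.top_mul hne]
        _ = ∫⁻ ω, E.indicator (fun _ => (⊤ : ℝ≥0∞)) ω ∂μ := by rw [lintegral_indicator_const hEm]
        _ ≤ ∫⁻ ω, ∑' y, botTransport G o ω y r * relWeight G R y ∂μ := by
            refine lintegral_mono fun ω => ?_
            by_cases hω : ω ∈ E
            · rw [Set.indicator_of_mem hω, tsum_botTransport_mul_relWeight_eq_top hconn hR hRne hω.1 hω.2]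
            · rw [Set.indicator_of_notMem hω]
              exact bot_le
    have htop : ∑ j ∈ R, (autWeight G o j)⁻¹ * ∫⁻ ω, ∑' y, botTransport G o ω y j * relWeight G R y ∂μ = ⊤ := by
      refine ENNReal.sum_eq_top.2 ⟨r, hr, ?_⟩
      rw [hge, ENNReal.mul_top (ENNReal.inv_ne_zero.2 (autWeight_ne_top G hconn o r))]
    rw [htop] at hmtp
    exact hle hmtp
  obtain ⟨r, hr, ⟨γ, rfl⟩⟩ := hR x
  rw [hμ, measure_botEvent_map hconn p γ r]
  exact hrep r hr

/-- **Almost surely no heavy cluster has a unique uppermost vertex** (quasi-transitive; any `p`).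
[cite: Timar2006, Lemma 5.2 (proof: MTP contradiction)] -/
theorem ae_not_isTopOf' (hconn : G.Connected) (hqt : IsQuasiTransitive G) (p : unitInterval) (o : V) :
    ∀ᵐ ω ∂(bondPercolation G p), ∀ x y, IsHeavy G o (openCluster ω x) → ¬ IsTopOf G o (openCluster ω x) y := by
  have h : ∀ y, ∀ᵐ ω ∂(bondPercolation G p),
      ¬ (IsHeavy G o (openCluster ω y) ∧ IsTopOf G o (openCluster ω y) y) := fun y =>
    measure_eq_zero_iff_ae_notMem.1 (measure_isHeavy_and_isTopOf_eq_zero' hconn hqt p o y)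
  rw [← ae_all_iff] at h
  filter_upwards [h] with ω hω x y hH hT
  have hC : openCluster ω y = openCluster ω x := openCluster_eq_openCluster_of_mem hT.1
  exact hω y ⟨hC ▸ hH, hC ▸ hT⟩

/-- **Almost surely no heavy cluster has a unique lowest vertex** (quasi-transitive; any `p`).
[cite: Timar2006, Lemma 5.2 (proof: MTP contradiction)] -/
theorem ae_not_isBotOf' (hconn : G.Connected) (hqt : IsQuasiTransitive G) (p : unitInterval) (o : V) :
    ∀ᵐ ω ∂(bondPercolation G p), ∀ x y, IsHeavy G o (openCluster ω x) → ¬ IsBotOf G o (openCluster ω x) y := by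
  have h : ∀ y, ∀ᵐ ω ∂(bondPercolation G p),
      ¬ (IsHeavy G o (openCluster ω y) ∧ IsBotOf G o (openCluster ω y) y) := fun y =>
    measure_eq_zero_iff_ae_notMem.1 (measure_isHeavy_and_isBotOf_eq_zero' hconn hqt p o y)
  rw [← ae_all_iff] at h
  filter_upwards [h] with ω hω x y hH hB
  have hC : openCluster ω y = openCluster ω x := openCluster_eq_openCluster_of_mem hB.1
  exact hω y ⟨hC ▸ hH, hC ▸ hB⟩

end NoExtremalVertex

/-! ### "By insertion tolerance": the walk surgery for an abstract key -/

section KeySurgery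

variable {G : SimpleGraph V} [G.LocallyFinite] {o : V}

/-- `y` is the unique `κ`-maximal vertex of `C`. (`κ = w`: unique top; `κ = w⁻¹`: unique bottom.)
[cite: Timar2006, Lemma 5.2 (proof: single uppermost / lowest vertex)] -/
def IsKeyTopOf (κ : V → ℝ≥0∞) (C : Set V) (y : V) : Prop :=
  y ∈ C ∧ ∀ z ∈ C, z ≠ y → κ z < κ y

omit [G.LocallyFinite] in
/-- Removing edges each of which contains a vertex outside `C(t)` does not change `C(t)`.
[folklore] -/
theorem openCluster_sdiff_eq_of_forall_exists_notMem' {ω : BondConfig V} {t : V} (E : Set (Sym2 V))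
    (hE : ∀ e ∈ E, ∃ z ∈ e, z ∉ openCluster ω t) : openCluster (ω \ E) t = openCluster ω t := by
  refine Set.Subset.antisymm (openCluster_mono (fun _ h => h.1) t) ?_
  have step : ∀ {c d : V}, c ∈ openCluster ω t → (openGraph ω).Adj c d →
      (openGraph (ω \ E)).Adj c d ∧ d ∈ openCluster ω t := by
    intro c d hc hadj
    have hopen : s(c, d) ∈ ω := ((openGraph_adj ω c d).1 hadj).1
    have hne : c ≠ d := ((openGraph_adj ω c d).1 hadj).2
    have hd : d ∈ openCluster ω t := mem_openCluster_of_adj hc hopen hne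
    have hnot : s(c, d) ∉ E := fun h => by
      obtain ⟨z, hz, hzC⟩ := hE _ h
      rcases Sym2.mem_iff.1 hz with rfl | rfl
      · exact hzC hc
      · exact hzC hd
    exact ⟨(openGraph_adj _ c d).2 ⟨⟨hopen, hnot⟩, hne⟩, hd⟩
  have key : ∀ {c d : V} (_ : (openGraph ω).Walk c d), c ∈ openCluster ω t →
      (openGraph (ω \ E)).Reachable c d := by
    intro c d W
    induction W with
    | nil => exact fun _ => SimpleGraph.Reachable.refl _
    | cons hadj _ ih =>
      intro hc
      obtain ⟨hadj', hd⟩ := step hc hadj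
      exact hadj'.reachable.trans (ih hd)
  intro u hu
  obtain ⟨W⟩ := hu
  exact key W (mem_openCluster_self ω t)

/-- **The walk surgery.** Let `f 0, …, f n` be a walk and `i* ≤ n` an index with
`κ(f i) < κ(f i*)` for `i < i*`; let `ω ⊆ E(G)` have `C(v)` heavy with all keys `< κ(f i*)`; let
`j < i*` with `f j ∈ C(v)` be such that `f i ∉ C(v)` for `j < i ≤ i*`. Closing the edges at
`f (j+1), …, f i*` and opening the edges `{f i, f (i+1)}`, `j ≤ i < i*`, produces a configuration
in which `C(f i*)` is heavy with `f i*` its unique `κ`-maximal vertex.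
[cite: Timar2006, Lemma 5.2 (proof: insertion tolerance, "a heavy cluster with a single uppermost vertex")] -/
theorem walk_mem_keyTopEvent [DecidableEq V] (κ : V → ℝ≥0∞) {v : V} {n : ℕ} {f : ℕ → V}
    (hf : ∀ i < n, G.Adj (f i) (f (i + 1))) {istar : ℕ} (histar : istar ≤ n)
    (hmax : ∀ i < istar, κ (f i) < κ (f istar))
    {ω : BondConfig V} (hω : ω ⊆ G.edgeSet) (hH : IsHeavy G o (openCluster ω v))
    (hlt : ∀ z ∈ openCluster ω v, κ z < κ (f istar))
    {j : ℕ} (hj : j < istar) (hjC : f j ∈ openCluster ω v)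
    (hafter : ∀ i, j < i → i ≤ istar → f i ∉ openCluster ω v) :
    let Ec : Finset (Sym2 V) := (Finset.Ico (j + 1) (istar + 1)).biUnion fun i => G.incidenceFinset (f i)
    let Eo : Finset (Sym2 V) := (Finset.Ico j istar).image fun i => s(f i, f (i + 1))
    IsHeavy G o (openCluster (openEdges ↑Eo (closeEdges ↑Ec ω)) (f istar)) ∧
      IsKeyTopOf κ (openCluster (openEdges ↑Eo (closeEdges ↑Ec ω)) (f istar)) (f istar) := by
  intro Ec Eo
  set ζ : BondConfig V := openEdges ↑Eo (closeEdges ↑Ec ω) with hζdef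
  have hmemEc : ∀ e : Sym2 V, e ∈ Ec ↔ ∃ i, j + 1 ≤ i ∧ i ≤ istar ∧ e ∈ G.edgeSet ∧ f i ∈ e := by
    intro e
    simp only [Ec, Finset.mem_biUnion, Finset.mem_Ico, SimpleGraph.mem_incidenceFinset]
    constructor
    · rintro ⟨i, ⟨h1, h2⟩, h3, h4⟩; exact ⟨i, h1, by omega, h3, h4⟩
    · rintro ⟨i, h1, h2, h3, h4⟩; exact ⟨i, ⟨h1, by omega⟩, h3, h4⟩
  have hmemEo : ∀ e : Sym2 V, e ∈ Eo ↔ ∃ i, j ≤ i ∧ i < istar ∧ s(f i, f (i + 1)) = e := by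
    intro e
    simp only [Eo, Finset.mem_image, Finset.mem_Ico]
    constructor
    · rintro ⟨i, ⟨h1, h2⟩, h3⟩
      exact ⟨i, h1, h2, h3⟩
    · rintro ⟨i, h1, h2, h3⟩
      exact ⟨i, ⟨h1, h2⟩, h3⟩
  -- (i) closing `Ec` does not touch `C(v)`
  have hCeq : openCluster (ω \ ↑Ec) v = openCluster ω v := by
    refine openCluster_sdiff_eq_of_forall_exists_notMem' _ fun e he => ?_
    rw [Finset.mem_coe, hmemEc] at he
    obtain ⟨i, hi1, hi2, -, hfi⟩ := he
    exact ⟨f i, hfi, hafter i (by omega) hi2⟩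
  -- (ii) the opened path joins `f j` to `f istar`
  have hpath : ∀ i, j ≤ i → i ≤ istar → f i ∈ openCluster ζ (f j) := by
    intro i hji hi
    induction i with
    | zero =>
      have : j = 0 := by omega
      subst this; exact mem_openCluster_self ζ _
    | succ i ih =>
      by_cases hij : j = i + 1
      · rw [← hij]; exact mem_openCluster_self ζ _
      · have hprev := ih (by omega) (by omega)
        have hadj : G.Adj (f i) (f (i + 1)) := hf i (by omega)
        have hopen : s(f i, f (i + 1)) ∈ ζ := by
          refine Or.inr ?_
          rw [Finset.mem_coe, hmemEo]
          exact ⟨i, by omega, by omega, rfl⟩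
        exact mem_openCluster_of_adj hprev hopen hadj.ne
  have hjstar : f istar ∈ openCluster ζ (f j) := hpath istar hj.le le_rfl
  -- (iii) `C(v) ⊆ C_ζ(f j)`
  have hsup : openCluster ω v ⊆ openCluster ζ (f j) := by
    rw [← hCeq]
    have hjC' : f j ∈ openCluster (ω \ ↑Ec) v := by rw [hCeq]; exact hjC
    rw [← openCluster_eq_openCluster_of_mem hjC']
    exact openCluster_mono Set.subset_union_left (f j)
  -- (iv) `C_ζ(f j) ⊆ {f i : j < i ≤ istar} ∪ C(v)`
  set S : Set V := {w | ∃ i, j < i ∧ i ≤ istar ∧ f i = w} with hS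
  have hstep : ∀ {a b : V}, (a ∈ S ∨ a ∈ openCluster ω v) → (openGraph ζ).Adj a b →
      (b ∈ S ∨ b ∈ openCluster ω v) := by
    intro a b ha hadj
    have hopen : s(a, b) ∈ ζ := ((openGraph_adj ζ a b).1 hadj).1
    have hne : a ≠ b := ((openGraph_adj ζ a b).1 hadj).2
    rcases hopen with ⟨hω', hnot⟩ | heo
    · rcases ha with ⟨i, hi1, hi2, rfl⟩ | haC
      · exfalso
        refine hnot ?_
        rw [Finset.mem_coe, hmemEc]
        exact ⟨i, by omega, hi2, hω hω', Sym2.mem_mk_left _ _⟩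
      · exact Or.inr (mem_openCluster_of_adj haC hω' hne)
    · rw [Finset.mem_coe, hmemEo] at heo
      obtain ⟨i, hi1, hi2, he⟩ := heo
      have hb : b = f i ∨ b = f (i + 1) := by
        have hbmem : b ∈ s(f i, f (i + 1)) := by rw [he]; exact Sym2.mem_mk_right a b
        rcases Sym2.mem_iff.1 hbmem with h | h
        · exact Or.inl h
        · exact Or.inr h
      rcases hb with rfl | rfl
      · by_cases hij : i = j
        · subst hij; exact Or.inr hjC
        · exact Or.inl ⟨i, by omega, by omega, rfl⟩
      · exact Or.inl ⟨i + 1, by omega, by omega, rfl⟩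
  have hkey : ∀ {a b : V} (_ : (openGraph ζ).Walk a b), (a ∈ S ∨ a ∈ openCluster ω v) →
      (b ∈ S ∨ b ∈ openCluster ω v) := by
    intro a b W
    induction W with
    | nil => exact id
    | cons hadj _ ih => exact fun ha => ih (hstep ha hadj)
  have hsub : openCluster ζ (f j) ⊆ S ∪ openCluster ω v := by
    intro u hu
    obtain ⟨W⟩ := hu
    exact hkey W (Or.inr hjC)
  have hCζ : openCluster ζ (f istar) = openCluster ζ (f j) := openCluster_eq_openCluster_of_mem hjstar
  rw [hCζ]
  refine ⟨hH.mono hsup, hjstar, ?_⟩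
  intro z hz hne
  rcases hsub hz with ⟨i, hi1, hi2, rfl⟩ | hzC
  · have : i < istar := lt_of_le_of_ne hi2 fun h => hne (by rw [h])
    exact hmax i this
  · exact hlt z hzC

variable [Countable V]

omit [G.LocallyFinite] in
/-- The event "`C(x)` is heavy and `y` is its unique `κ`-maximal vertex" is measurable. [folklore] -/
theorem measurableSet_isHeavy_and_isKeyTopOf (κ : V → ℝ≥0∞) (o x y : V) :
    MeasurableSet {ω : BondConfig V | IsHeavy G o (openCluster ω x) ∧ IsKeyTopOf κ (openCluster ω x) y} := by
  have hrepr : {ω : BondConfig V | IsKeyTopOf κ (openCluster ω x) y} =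
      {ω | (openGraph ω).Reachable x y} ∩
        ⋂ z, ({ω | (openGraph ω).Reachable x z}ᶜ ∪ {_ω | z ≠ y → κ z < κ y}) := by
    ext ω
    simp only [IsKeyTopOf, openCluster, Set.mem_setOf_eq, Set.mem_inter_iff, Set.mem_iInter,
      Set.mem_union, Set.mem_compl_iff]
    refine and_congr_right fun _ => forall_congr' fun z => ?_
    exact ⟨fun h => (em ((openGraph ω).Reachable x z)).elim (fun hr => Or.inr (h hr)) Or.inl,
      fun h hr => h.elim (fun hn => absurd hr hn) id⟩
  have hK : MeasurableSet {ω : BondConfig V | IsKeyTopOf κ (openCluster ω x) y} := by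
    rw [hrepr]
    refine (measurableSet_openConn_holds x y).inter (MeasurableSet.iInter fun z => ?_)
    exact (measurableSet_openConn_holds x z).compl.union (MeasurableSet.const _)
  exact (measurableSet_isHeavy_openCluster G o x).inter hK

/-- **"By insertion tolerance, there would also be a heavy cluster with a single uppermost
vertex"**, abstract key form: if the events "`C(y)` heavy with unique `κ`-maximal vertex `y`" are
all null, and from every vertex `v` a walk of length `≤ R₁` reaches a vertex of key
`≥ bound(v)`, then for `0 < p < 1`, almost surely, if `C(v)` is heavy NOT every vertex of `C(v)`
has key `< bound(v)`. Proof: take the first `κ`-highest vertex of the walk and the last visit to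
`C(v)` before it, and apply `walk_mem_keyTopEvent` (deletion tolerance for the closed star,
insertion tolerance for the opened path). [cite: Timar2006, Lemma 5.2 (proof: deletion and insertion tolerance)] -/
theorem ae_not_forall_key_lt {p : unitInterval} (hp0 : 0 < (p : ℝ))
    (hp1 : (p : ℝ) < 1) (o : V) (κ : V → ℝ≥0∞) (bound : V → ℝ≥0∞)
    (hnull : ∀ y : V, bondPercolation G p
      {ω | IsHeavy G o (openCluster ω y) ∧ IsKeyTopOf κ (openCluster ω y) y} = 0)
    {R₁ : ℕ}
    (hwalk : ∀ v : V, ∃ n ≤ R₁, ∃ f : ℕ → V, f 0 = v ∧ (∀ i < n, G.Adj (f i) (f (i + 1))) ∧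
      bound v ≤ κ (f n)) :
    ∀ᵐ ω ∂(bondPercolation G p), ∀ v, IsHeavy G o (openCluster ω v) →
      ¬ ∀ z ∈ openCluster ω v, κ z < bound v := by
  classical
  set μ := bondPercolation G p with hμ
  rw [ae_all_iff]
  intro v
  set A := {ω : BondConfig V | IsHeavy G o (openCluster ω v) ∧
    ∀ z ∈ openCluster ω v, κ z < bound v} with hA
  suffices hA0 : μ A = 0 by
    filter_upwards [measure_eq_zero_iff_ae_notMem.1 hA0] with ω hω hH hall using hω ⟨hH, hall⟩
  by_contra hne
  obtain ⟨n, -, f, hf0, hf, hbound⟩ := hwalk v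
  -- the first index attaining the maximum of `κ ∘ f` on `[0, n]`
  obtain ⟨istar, histar, hmaxval⟩ : ∃ i ≤ n, IsGreatest ((fun i => κ (f i)) '' {i | i ≤ n}) (κ (f i)) := by
    have hfin : ((fun i => κ (f i)) '' {i | i ≤ n}).Finite := (Set.finite_Iic n).image _
    obtain ⟨m, ⟨i, hi, rfl⟩, hm⟩ := Set.Finite.exists_maximalFor id _ hfin ⟨_, ⟨0, Nat.zero_le n, rfl⟩⟩
    refine ⟨i, hi, ⟨i, hi, rfl⟩, fun m' hm' => ?_⟩
    rcases le_total m' (κ (f i)) with h | h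
    · exact h
    · exact hm hm' h
  have hex : ∃ i, i ≤ n ∧ κ (f i) = κ (f istar) := ⟨istar, histar, rfl⟩
  set i₀ := Nat.find hex with hi₀
  have hi₀spec := Nat.find_spec hex
  have hi₀n : i₀ ≤ n := hi₀spec.1
  have hi₀eq : κ (f i₀) = κ (f istar) := hi₀spec.2
  have hmax : ∀ i < i₀, κ (f i) < κ (f i₀) := by
    intro i hi
    have hle : κ (f i) ≤ κ (f istar) := hmaxval.2 ⟨i, ((le_of_lt hi).trans hi₀n : i ∈ {i | i ≤ n}), rfl⟩
    rw [hi₀eq]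
    refine lt_of_le_of_ne hle fun heq => ?_
    exact Nat.find_min hex hi ⟨(le_of_lt hi).trans hi₀n, heq⟩
  have hcv : bound v ≤ κ (f i₀) := by
    rw [hi₀eq]
    exact hbound.trans (hmaxval.2 ⟨n, (le_refl n : n ∈ {i | i ≤ n}), rfl⟩)
  -- the null target event at `f i₀`
  set T := {ω : BondConfig V | IsHeavy G o (openCluster ω (f i₀)) ∧ IsKeyTopOf κ (openCluster ω (f i₀)) (f i₀)}
    with hT
  have hTm : MeasurableSet T := measurableSet_isHeavy_and_isKeyTopOf κ o (f i₀) (f i₀)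
  have hT0 : μ T = 0 := hnull (f i₀)
  -- decompose `A ∩ {ω ⊆ E(G)}` by the last index `j < i₀` with `f j ∈ C(v)`
  set B : ℕ → Set (BondConfig V) := fun j =>
    (A ∩ {ω | ω ⊆ G.edgeSet}) ∩ ({ω | f j ∈ openCluster ω v} ∩
      {ω | ∀ i, j < i → i ≤ i₀ → f i ∉ openCluster ω v}) with hB
  have hApos : μ (A ∩ {ω | ω ⊆ G.edgeSet}) ≠ 0 := measure_inter_ne_zero_of_ae hne setBernoulli_ae_subset
  have hcover : A ∩ {ω | ω ⊆ G.edgeSet} ⊆ ⋃ j ∈ Finset.range i₀, B j := by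
    rintro ω ⟨⟨hH, hall⟩, hωE⟩
    have hnot : f i₀ ∉ openCluster ω v := fun h => lt_irrefl _ ((hall _ h).trans_le hcv)
    have hgood0 : f 0 ∈ openCluster ω v := by rw [hf0]; exact mem_openCluster_self ω v
    have hi₀pos : 0 < i₀ := by
      by_contra h0
      have : i₀ = 0 := by omega
      rw [this] at hnot
      exact hnot hgood0
    set J : Finset ℕ := (Finset.range i₀).filter fun i => f i ∈ openCluster ω v with hJ
    have hJne : J.Nonempty := ⟨0, by simp [hJ, hi₀pos, hgood0]⟩
    set j := J.max' hJne with hjdef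
    have hjJ : j ∈ J := Finset.max'_mem J hJne
    simp only [hJ, Finset.mem_filter, Finset.mem_range] at hjJ
    refine Set.mem_biUnion (Finset.mem_range.2 hjJ.1) ⟨⟨⟨hH, hall⟩, hωE⟩, hjJ.2, fun i hji hi => ?_⟩
    by_cases hii : i = i₀
    · rw [hii]; exact hnot
    · intro hiC
      have hiJ : i ∈ J := by simp [hJ, hiC]; omega
      have := Finset.le_max' J i hiJ
      rw [← hjdef] at this
      omega
  obtain ⟨j, hj, hBj⟩ : ∃ j, j < i₀ ∧ μ (B j) ≠ 0 := by
    by_contra h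
    push Not at h
    have hle' : μ (A ∩ {ω | ω ⊆ G.edgeSet}) ≤ ∑ j ∈ Finset.range i₀, μ (B j) :=
      (measure_mono hcover).trans (measure_biUnion_finset_le _ _)
    have hzero : ∑ j ∈ Finset.range i₀, μ (B j) = 0 :=
      Finset.sum_eq_zero fun j hj => h j (Finset.mem_range.1 hj)
    rw [hzero, nonpos_iff_eq_zero] at hle'
    exact hApos hle'
  have hBpos : 0 < μ.real (B j) := ENNReal.toReal_pos hBj (measure_ne_top _ _)
  set F₁ : Finset (Sym2 V) := (Finset.Ico (j + 1) (i₀ + 1)).biUnion fun i => G.incidenceFinset (f i)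
  set F₂ : Finset (Sym2 V) := (Finset.Ico j i₀).image fun i => s(f i, f (i + 1))
  set E : Set (BondConfig V) := openEdges ↑F₂ ⁻¹' T with hEdef
  have hEm : MeasurableSet E := measurable_openEdges _ hTm
  have hE : 0 < μ.real E := by
    refine bondPercolation_real_pos_of_closeEdges G hp1 F₁ hEm hBpos fun ω hω => ?_
    obtain ⟨⟨⟨hH, hall⟩, hωG⟩, hjC, hafter⟩ := hω
    have hlt : ∀ z ∈ openCluster ω v, κ z < κ (f i₀) := fun z hz => (hall z hz).trans_le hcv
    exact walk_mem_keyTopEvent κ hf hi₀n hmax hωG hH hlt hj hjC hafter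
  have hF₂ : (↑F₂ : Set (Sym2 V)) ⊆ G.edgeSet := by
    intro e he
    rw [Finset.mem_coe, Finset.mem_image] at he
    obtain ⟨i, hi, rfl⟩ := he
    rw [Finset.mem_Ico] at hi
    exact hf i (by omega)
  have hpos := bondPercolation_real_pos_of_openEdges G hp0 F₂ hF₂ hTm hE fun ω hω => hω
  rw [measureReal_def, hT0, ENNReal.toReal_zero] at hpos
  exact lt_irrefl _ hpos

end KeySurgery

/-! ### No heavy cluster is bounded in weight (up: climbs; down: descents) -/

section Unbounded

variable [Countable V] {G : SimpleGraph V} [G.LocallyFinite]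

omit [Countable V] [G.LocallyFinite] in
/-- `IsTopOf` is `IsKeyTopOf` for the key `w`. [folklore] -/
theorem isKeyTopOf_autWeight_iff (o : V) (C : Set V) (y : V) :
    IsKeyTopOf (autWeight G o) C y ↔ IsTopOf G o C y := Iff.rfl

omit [Countable V] [G.LocallyFinite] in
/-- `IsBotOf` is `IsKeyTopOf` for the key `w⁻¹`. [folklore] -/
theorem isKeyTopOf_inv_autWeight_iff (o : V) (C : Set V) (y : V) :
    IsKeyTopOf (fun z => (autWeight G o z)⁻¹) C y ↔ IsBotOf G o C y := by
  simp only [IsKeyTopOf, IsBotOf]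
  refine and_congr_right fun _ => forall₂_congr fun z _ => imp_congr_right fun _ => ?_
  exact ENNReal.inv_lt_inv

/-- **Upwards**: with the climb constant `c > 1` of `exists_climb`, for `0 < p < 1`, almost
surely, if `C(v)` is heavy then NOT every vertex of `C(v)` has weight `< c w(v)`.
[cite: Timar2006, Lemma 5.2 (proof: deletion and insertion tolerance)] -/
theorem ae_not_forall_autWeight_lt_mul (hconn : G.Connected) (hqt : IsQuasiTransitive G)
    {p : unitInterval} (hp0 : 0 < (p : ℝ)) (hp1 : (p : ℝ) < 1) (o : V) {c : ℝ≥0∞} {R₁ : ℕ}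
    (hclimb : ∀ v : V, ∃ n ≤ R₁, ∃ f : ℕ → V, f 0 = v ∧ (∀ i < n, G.Adj (f i) (f (i + 1))) ∧
      autWeight G o (f n) = c * autWeight G o v) :
    ∀ᵐ ω ∂(bondPercolation G p), ∀ v, IsHeavy G o (openCluster ω v) →
      ¬ ∀ z ∈ openCluster ω v, autWeight G o z < c * autWeight G o v := by
  refine ae_not_forall_key_lt hp0 hp1 o (autWeight G o) (fun v => c * autWeight G o v)
    (fun y => measure_isHeavy_and_isTopOf_eq_zero' hconn hqt p o y) (R₁ := R₁) fun v => ?_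
  obtain ⟨n, hn, f, hf0, hf, hw⟩ := hclimb v
  exact ⟨n, hn, f, hf0, hf, hw.ge⟩

/-- **Downwards**: with the constant `c > 1` of `exists_descent`, for `0 < p < 1`, almost surely,
if `C(v)` is heavy then NOT every vertex `z` of `C(v)` has `w(v) < c w(z)`.
[cite: Timar2006, Lemma 5.2 (proof: deletion and insertion tolerance)] -/
theorem ae_not_forall_lt_mul_autWeight (hconn : G.Connected) (hqt : IsQuasiTransitive G)
    {p : unitInterval} (hp0 : 0 < (p : ℝ)) (hp1 : (p : ℝ) < 1) (o : V) {c : ℝ≥0∞} (hcT : c ≠ ⊤)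
    {R₁ : ℕ}
    (hdesc : ∀ v : V, ∃ n ≤ R₁, ∃ f : ℕ → V, f 0 = v ∧ (∀ i < n, G.Adj (f i) (f (i + 1))) ∧
      c * autWeight G o (f n) = autWeight G o v) :
    ∀ᵐ ω ∂(bondPercolation G p), ∀ v, IsHeavy G o (openCluster ω v) →
      ¬ ∀ z ∈ openCluster ω v, autWeight G o v < c * autWeight G o z := by
  have hnull : ∀ y : V, bondPercolation G p
      {ω | IsHeavy G o (openCluster ω y) ∧ IsKeyTopOf (fun z => (autWeight G o z)⁻¹) (openCluster ω y) y} = 0 := by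
    intro y
    simp only [isKeyTopOf_inv_autWeight_iff o]
    exact measure_isHeavy_and_isBotOf_eq_zero' hconn hqt p o y
  have h := ae_not_forall_key_lt hp0 hp1 o (fun z => (autWeight G o z)⁻¹)
    (fun v => c * (autWeight G o v)⁻¹) hnull (R₁ := R₁) (fun v => ?_)
  · filter_upwards [h] with ω hω v hH hall
    refine hω v hH fun z hz => ?_
    -- `w(v) < c w(z)` gives `w(z)⁻¹ < c w(v)⁻¹`
    have hz0 := autWeight_ne_zero G hconn o z
    have hzT := autWeight_ne_top G hconn o z
    have hv0 := autWeight_ne_zero G hconn o v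
    have hvT := autWeight_ne_top G hconn o v
    have h1 := hall z hz
    calc (autWeight G o z)⁻¹ = (autWeight G o v)⁻¹ * (autWeight G o v * (autWeight G o z)⁻¹) := by
          rw [← mul_assoc, ENNReal.inv_mul_cancel hv0 hvT, one_mul]
      _ < (autWeight G o v)⁻¹ * (c * autWeight G o z * (autWeight G o z)⁻¹) := by
          refine ENNReal.mul_lt_mul_right (ENNReal.inv_ne_zero.2 hvT) (ENNReal.inv_ne_top.2 hv0) ?_
          exact ENNReal.mul_lt_mul_left (ENNReal.inv_ne_zero.2 hzT) (ENNReal.inv_ne_top.2 hz0) h1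
      _ = c * (autWeight G o v)⁻¹ := by
          rw [mul_assoc, ENNReal.mul_inv_cancel hz0 hzT, mul_one, mul_comm]
  · obtain ⟨n, hn, f, hf0, hf, hw⟩ := hdesc v
    refine ⟨n, hn, f, hf0, hf, le_of_eq ?_⟩
    -- `c w(v)⁻¹ = w(f n)⁻¹` from `c w(f n) = w(v)`
    have h0 := autWeight_ne_zero G hconn o (f n)
    have hT := autWeight_ne_top G hconn o (f n)
    have hc0 : c ≠ 0 := by
      intro hc; rw [hc, zero_mul] at hw; exact autWeight_ne_zero G hconn o v hw.symm
    rw [← hw, ENNReal.mul_inv (Or.inl hc0) (Or.inl hcT), ← mul_assoc, ENNReal.mul_inv_cancel hc0 hcT, one_mul]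

/-- **Almost surely no heavy cluster is bounded in weight from above** (`0 < p < 1`).
[cite: Timar2006, Lemma 5.2 (proof)] -/
theorem ae_exists_lt_autWeight' (hconn : G.Connected) (hqt : IsQuasiTransitive G)
    (hU : ¬ IsGraphUnimodular G) {p : unitInterval} (hp0 : 0 < (p : ℝ)) (hp1 : (p : ℝ) < 1) (o : V) :
    ∀ᵐ ω ∂(bondPercolation G p), ∀ x, IsHeavy G o (openCluster ω x) →
      ∀ t : ℝ≥0∞, t ≠ ⊤ → ∃ z ∈ openCluster ω x, t < autWeight G o z := by
  obtain ⟨c, h1c, hcT, R₁, hclimb⟩ := exists_climb hconn hqt hU o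
  have hc0 : c ≠ 0 := (zero_lt_one.trans h1c).ne'
  filter_upwards [ae_not_forall_autWeight_lt_mul hconn hqt hp0 hp1 o hclimb] with ω hω x hH t htT
  by_contra hno
  push Not at hno
  set s : ℝ≥0∞ := ⨆ z ∈ openCluster ω x, autWeight G o z with hs
  have hsT : s ≠ ⊤ := ne_top_of_le_ne_top htT (iSup₂_le hno)
  have hs0 : s ≠ 0 := by
    refine fun h0 => autWeight_ne_zero G hconn o x (le_antisymm ?_ bot_le)
    exact h0 ▸ le_iSup₂ (f := fun z (_ : z ∈ openCluster ω x) => autWeight G o z) x (mem_openCluster_self ω x)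
  have hlt : s / c < s := by
    rw [ENNReal.div_lt_iff (Or.inl hc0) (Or.inl hcT)]
    calc s = s * 1 := (mul_one s).symm
      _ < s * c := ENNReal.mul_lt_mul_right hs0 hsT h1c
  rw [hs, lt_biSup_iff] at hlt
  obtain ⟨v, hv, hvlt⟩ := hlt
  have hC : openCluster ω v = openCluster ω x := openCluster_eq_openCluster_of_mem hv
  refine hω v (hC ▸ hH) fun z hz => ?_
  rw [hC] at hz
  calc autWeight G o z ≤ s := le_iSup₂ (f := fun z (_ : z ∈ openCluster ω x) => autWeight G o z) z hz
    _ = c * (s / c) := (ENNReal.mul_div_cancel hc0 hcT).symm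
    _ < c * autWeight G o v := ENNReal.mul_lt_mul_right hc0 hcT hvlt

/-- **Almost surely no heavy cluster is bounded in weight from below** (`0 < p < 1`).
[cite: Timar2006, Lemma 5.2 (proof)] -/
theorem ae_exists_autWeight_lt' (hconn : G.Connected) (hqt : IsQuasiTransitive G)
    (hU : ¬ IsGraphUnimodular G) {p : unitInterval} (hp0 : 0 < (p : ℝ)) (hp1 : (p : ℝ) < 1) (o : V) :
    ∀ᵐ ω ∂(bondPercolation G p), ∀ x, IsHeavy G o (openCluster ω x) →
      ∀ t : ℝ≥0∞, t ≠ 0 → ∃ z ∈ openCluster ω x, autWeight G o z < t := by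
  obtain ⟨c, h1c, hcT, R₁, hdesc⟩ := exists_descent hconn hqt hU o
  have hc0 : c ≠ 0 := (zero_lt_one.trans h1c).ne'
  filter_upwards [ae_not_forall_lt_mul_autWeight hconn hqt hp0 hp1 o hcT hdesc] with ω hω x hH t ht0
  by_contra hno
  push Not at hno
  set i : ℝ≥0∞ := ⨅ z ∈ openCluster ω x, autWeight G o z with hi
  have hi0 : i ≠ 0 := (lt_of_lt_of_le (pos_iff_ne_zero.2 ht0) (le_iInf₂ hno)).ne'
  have hiT : i ≠ ⊤ := ne_top_of_le_ne_top (autWeight_ne_top G hconn o x)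
    (iInf₂_le (f := fun z (_ : z ∈ openCluster ω x) => autWeight G o z) x (mem_openCluster_self ω x))
  have hlt : i < c * i := by
    calc i = 1 * i := (one_mul i).symm
      _ < c * i := ENNReal.mul_lt_mul_left hi0 hiT h1c
  rw [hi, iInf_lt_iff] at hlt
  obtain ⟨v, hvlt⟩ := hlt
  rw [iInf_lt_iff] at hvlt
  obtain ⟨hv, hvlt⟩ := hvlt
  have hC : openCluster ω v = openCluster ω x := openCluster_eq_openCluster_of_mem hv
  refine hω v (hC ▸ hH) fun z hz => ?_
  rw [hC] at hz
  calc autWeight G o v < c * i := hvlt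
    _ ≤ c * autWeight G o z := by
        gcongr
        exact iInf₂_le (f := fun z (_ : z ∈ openCluster ω x) => autWeight G o z) z hz

end Unbounded

/-! ### Lemma 5.2 and its corollary for heavy branches -/

section LemmaFiveTwo

variable [Countable V] {G : SimpleGraph V} [G.LocallyFinite]

/-- **Timár 2006, Lemma 5.2, PROVED on quasi-transitive graphs** — "A heavy cluster intersects
every slab in infinitely many vertices": on a connected, locally finite, quasi-transitive
nonunimodular graph, under Bernoulli(`p`) bond percolation with `0 < p < 1`, for every slab
`L = {a < w ≤ b}` with `a ≤ δ b` (`δ = minEdgeRatio G`), `0 < b < ∞`: almost surely every heavy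
open cluster meets `L` in infinitely many vertices. Proof as printed.
[cite: Timar2006, Lemma 5.2] [cite: Hutchcroft2016, §2 (quasi-transitive setting)] -/
theorem ae_infinite_inter_weightSlab_quasiTransitive (hconn : G.Connected) (hqt : IsQuasiTransitive G)
    (hU : ¬ IsGraphUnimodular G) {p : unitInterval} (hp0 : 0 < (p : ℝ)) (hp1 : (p : ℝ) < 1) (o : V)
    {a b : ℝ≥0∞} (hab : a ≤ minEdgeRatio G * b) (hb0 : b ≠ 0) (hbT : b ≠ ⊤) :
    ∀ᵐ ω ∂(bondPercolation G p), ∀ x, IsHeavy G o (openCluster ω x) →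
      (openCluster ω x ∩ weightSlab G o a b).Infinite := by
  classical
  set μ := bondPercolation G p with hμ
  set L := weightSlab G o a b with hL
  have haT : a ≠ ⊤ := ne_top_of_le_ne_top (ENNReal.mul_ne_top (minEdgeRatio_ne_top hconn hU) hbT) hab
  set Up : V → Set (BondConfig V) := fun z =>
    {ω | IsHeavy G o (openCluster ω z) ∧ ∀ y ∈ openCluster ω z, b < autWeight G o y} with hUp
  set Down : V → Set (BondConfig V) := fun z =>
    {ω | IsHeavy G o (openCluster ω z) ∧ ∀ y ∈ openCluster ω z, autWeight G o y ≤ a} with hDown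
  have hnull : ∀ z, μ (Up z ∪ Down z) = 0 := by
    intro z
    refine measure_union_null ?_ ?_
    · refine measure_mono_null (fun ω hω => ?_) (ae_iff.1 (ae_exists_autWeight_lt' hconn hqt hU hp0 hp1 o))
      intro hall
      obtain ⟨y, hy, hyb⟩ := hall z hω.1 b hb0
      exact absurd (hω.2 y hy) (not_lt.2 hyb.le)
    · refine measure_mono_null (fun ω hω => ?_) (ae_iff.1 (ae_exists_lt_autWeight' hconn hqt hU hp0 hp1 o))
      intro hall
      obtain ⟨y, hy, hya⟩ := hall z hω.1 a haT
      exact absurd (hω.2 y hy) (not_le.2 hya)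
  have hmeas : ∀ z, MeasurableSet (Up z ∪ Down z) := fun z =>
    (measurableSet_isHeavy_and_forall_mem o z _).union (measurableSet_isHeavy_and_forall_mem o z _)
  rw [ae_all_iff]
  intro x
  set B : Finset V → Set (BondConfig V) := fun K =>
    {ω | IsHeavy G o (openCluster ω x) ∧ openCluster ω x ∩ L = ↑K} with hB
  suffices hBK : ∀ K, μ (B K) = 0 by
    have h0 : μ (⋃ K, B K) = 0 := measure_iUnion_null hBK
    filter_upwards [measure_eq_zero_iff_ae_notMem.1 h0] with ω hω hH
    by_contra hfin
    rw [Set.not_infinite] at hfin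
    exact hω (Set.mem_iUnion.2 ⟨hfin.toFinset, hH, by rw [Set.Finite.coe_toFinset]⟩)
  intro K
  by_contra hne
  set F : Finset (Sym2 V) := edgesAt G K with hF
  set N : Finset V := insert x (K.biUnion fun k => G.neighborFinset k) with hN
  have hcover : B K ∩ {ω | ω ⊆ G.edgeSet} ⊆ ⋃ z ∈ (↑N : Set V), closeEdges ↑F ⁻¹' (Up z ∪ Down z) := by
    rintro ω ⟨⟨hH, hK⟩, hωE⟩
    set ω' := closeEdges ↑F ω with hω'
    have hω'E : ω' ⊆ G.edgeSet := (closeEdges_subset _ ω).trans hωE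
    obtain ⟨z, hzN, hz⟩ := hH.exists_isHeavy_inter hconn K.finite_toSet N
      (fun z => openCluster ω' z) (openCluster_subset_closeEdges_edgesAt hωE x)
    obtain ⟨hzK, hheavy, hdisjK, hsub⟩ := closeEdges_edgesAt_piece hconn hωE hz
    have hdisjL : Disjoint (openCluster ω' z) L := by
      rw [Set.disjoint_left]
      intro y hy hyL
      have : y ∈ (↑K : Set V) := by rw [← hK]; exact ⟨hsub hy, hyL⟩
      exact Set.disjoint_left.1 hdisjK hy this
    refine Set.mem_biUnion (Finset.mem_coe.2 hzN) ?_
    change ω' ∈ Up z ∪ Down z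
    have hzL : z ∉ L := Set.disjoint_left.1 hdisjL (mem_openCluster_self ω' z)
    by_cases hzb : b < autWeight G o z
    · exact Or.inl ⟨hheavy, forall_lt_autWeight_of_disjoint_weightSlab' hconn hab hω'E hzb hdisjL⟩
    · have hza : autWeight G o z ≤ a := by
        by_contra h
        exact hzL ⟨not_le.1 h, not_lt.1 hzb⟩
      exact Or.inr ⟨hheavy, forall_autWeight_le_of_disjoint_weightSlab' hconn hU hab hω'E hza hdisjL⟩
  have hpos : μ (⋃ z ∈ (↑N : Set V), closeEdges ↑F ⁻¹' (Up z ∪ Down z)) ≠ 0 := fun h0 =>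
    measure_inter_ne_zero_of_ae hne setBernoulli_ae_subset (measure_mono_null hcover h0)
  rw [Ne, measure_biUnion_null_iff N.countable_toSet, not_forall] at hpos
  obtain ⟨z, hz⟩ := hpos
  rw [Classical.not_imp] at hz
  obtain ⟨-, hz⟩ := hz
  have hpos₁ : 0 < μ.real (Up z ∪ Down z) :=
    bondPercolation_real_pos_of_closeEdges G hp1 F (hmeas z)
      (ENNReal.toReal_pos hz (measure_ne_top _ _)) fun ω hω => hω
  rw [measureReal_def, hnull z, ENNReal.toReal_zero] at hpos₁
  exact lt_irrefl _ hpos₁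

/-- **A heavy branch meets every slab in infinitely many vertices** ("`C ∩ L₀` is infinite (by
deletion tolerance and Lemma 5.2)", proof of Lemma 5.3), quasi-transitive form of
`ae_infinite_branchSet_inter_weightSlab`. [cite: Timar2006, Lemma 5.3 (proof: "C ∩ L₀ is infinite, by deletion tolerance and Lemma 5.2")] -/
theorem ae_infinite_branchSet_inter_weightSlab' (hconn : G.Connected) (hqt : IsQuasiTransitive G)
    (hU : ¬ IsGraphUnimodular G) {p : unitInterval} (hp0 : 0 < (p : ℝ)) (hp1 : (p : ℝ) < 1) (o : V)
    {a b : ℝ≥0∞} (hab : a ≤ minEdgeRatio G * b) (hb0 : b ≠ 0) (hbT : b ≠ ⊤) :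
    ∀ᵐ ω ∂(bondPercolation G p), ∀ x u, IsHeavy G o (branchSet ω x u) →
      (branchSet ω x u ∩ weightSlab G o a b).Infinite := by
  classical
  set μ := bondPercolation G p with hμ
  set L := weightSlab G o a b with hL
  set E : V → Set (BondConfig V) := fun u =>
    {ω | IsHeavy G o (openCluster ω u) ∧ (openCluster ω u ∩ L).Finite} with hE
  have hEnull : ∀ u, μ (E u) = 0 := by
    intro u
    refine measure_mono_null ?_
      (ae_iff.1 (ae_infinite_inter_weightSlab_quasiTransitive hconn hqt hU hp0 hp1 o hab hb0 hbT))
    intro ω hω hall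
    exact (hall u hω.1) hω.2
  have hEm : ∀ u, MeasurableSet (E u) := fun u =>
    (measurableSet_isHeavy_openCluster G o u).inter (measurableSet_finite_openCluster_inter u L)
  rw [ae_all_iff]; intro x
  rw [ae_all_iff]; intro u
  by_cases hux : u = x
  · subst hux
    filter_upwards with ω hH
    rw [branchSet_self] at hH
    exact absurd hH (not_isHeavy_of_finite G hconn o Set.finite_empty)
  set A := {ω : BondConfig V | IsHeavy G o (branchSet ω x u) ∧ (branchSet ω x u ∩ L).Finite} with hA
  suffices hA0 : μ A = 0 by
    filter_upwards [measure_eq_zero_iff_ae_notMem.1 hA0] with ω hω hH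
    by_contra hfin
    exact hω ⟨hH, Set.not_infinite.1 hfin⟩
  by_contra hne
  have hpos : 0 < μ.real (E u) := by
    refine bondPercolation_real_pos_of_closeEdges G hp1 (edgesAt G {x}) (hEm u)
      (ENNReal.toReal_pos (measure_inter_ne_zero_of_ae hne setBernoulli_ae_subset) (measure_ne_top _ _))
      ?_
    rintro ω ⟨⟨hH, hfin⟩, hωE⟩
    rw [hE, Set.mem_setOf_eq, ← branchSet_eq_openCluster_closeEdges hωE hux]
    exact ⟨hH, hfin⟩
  rw [measureReal_def, hEnull u, ENNReal.toReal_zero] at hpos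
  exact lt_irrefl _ hpos

end LemmaFiveTwo

end Literature.Barriers.CriticalPhenomena

end
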